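import Summits.QuantumFields.QCD.Theses.FourMirrorsWardE1
import Summits.QuantumFields.QCD.Theses.DiagonalSpine
import Summits.QuantumFields.QCD.Theses.GapBuysCauchyRate
import Summits.QuantumFields.YangMills.Theorems.LangevinControlUVOSLegsFromFemtoAndGapStubUpgrade
import HarnessLib.Audit

/-!
# Line `sigma-five-amnesia` for crux `RotationRestoration` (item stmt-QuantumFields-8840)

Crux-strategist ALTERNATIVE line (unit `cstrat-stmt-QuantumFields-8840-s1`, 2026-08-17); it does NOT
replace the line-neutral birth skeleton `Lines/birth.lean` (stubs `stub_hypercubicOnSeparatedTensors`,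
`stub_planarWardOnSeparatedTensors`, `stub_separatedTensorsTotal`), it offers the lead a SECOND ENGINE for
the hard step.  Crux (shared verbatim by `FourMirrorsWardE1` r3 (primary) / `DiagonalSpine` r4 /
`GapBuysCauchyRate` r5): every labelled Schwinger family `S` that is the `k → ∞` limit of the honest
lattice-QCD `n`-point functions of a two-loop asymptotically scaling, physical-branch, uniformly gapped
scheme is invariant on `⁰𝒮` under every determinant-one linear isometry of `ℝ⁴`.

TRANSFER (lens at crux level) of the Yang–Mills sibling's alternative E1 engine — route
`YangMills/Theses/CoincidenceRotationBootstrap` (cruxes `CurvatureAmnesia` + the PROVED support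
`EuclideanUpgrade`, stmt-QuantumFields-8647, landed as
`Summit.QuantumFields.YangMills.Theorems.OSLegsFromFemtoAndGap.Upgrade.upgrade`, polymorphic in the label
type) — to exactly this step of the QCD conjunct, which the crux text itself names as its alternative engine
("Σ5 commensurate self-comparison, card coincidence-lattice-rotation-bootstrap; never diagonal mirrors"):

* `stub_hypercubicOnSeparatedTensors : HypercubicOnSeparatedTensors` — BYTE-IDENTICAL with the birth
  line's stub of the same name (one proof serves both lines): exact site-centred hyperoctahedral symmetry of
  honest lattice QCD passes to every limit family on separated real tensors (size M/L, provable in kind).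
* `stub_sigmaFiveOnSeparatedTensors : SigmaFiveOnSeparatedTensors` — THE HARD STUB (open-problem;
  replaces birth's `stub_planarWardOnSeparatedTensors`): under the crux's hypotheses, every limit family is
  invariant on separated real tensors under ONE isometry, the Σ5 coincidence rotation `R` of the SPATIAL
  `(x₂,x₃)`-plane (`R e₀ = e₀`, `R e₁ = e₁`, `R e₂ = (3e₂+4e₃)/5`, `R e₃ = (−4e₂+3e₃)/5`; `ℤ⁴ ∩ Rℤ⁴` has index
  5, `R(5ℤ⁴) ⊂ ℤ⁴`).  Why this and not a Ward identity: `R` FIXES THE TIME AXIS, so Wilson's theory on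
  `a_kℤ⁴` and its relabelled copy on `R(a_kℤ⁴)` (whose `n`-point functions tested on `f` are the original
  ones tested on `f ∘ R`) are two site-reflection-positive lattice theories with the SAME Euclidean time,
  the same transfer-matrix formalism (Lüscher, `m_f > −1`), the same couplings `(β_k, m_f(k))` and a common
  time-slice sublattice `Γ = ℤ² × (ℤ² ∩ R_{34}ℤ²)` of index 5; the stub is the asymptotic agreement of the
  two on Γ-measurable separated observables — a ONE-STEP COMMENSURATE SELF-COMPARISON needing no lattice
  energy–momentum tensor, no operator mixing / `Z_T`, no angular derivative, and no diagonal mirror.  The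
  open core is the same as every E1 engine's (non-perturbative irrelevance, through the crossover, of the
  `W(B₄)`-scalar `O(4)`-breaking dimension-6 operators that distinguish the two frames: Symanzik 1983,
  Weisz 1983, Lüscher–Weisz 1985; numerically Lang–Rebbi 1982, Davoudi–Savage 2012).
* `stub_separatedTensorsTotal : SeparatedTensorsTotal` — BYTE-IDENTICAL with the birth line's stub
  (functional analysis, size L): separated real tensors are total in `⁰𝒮`.

Composition `RotationRestoration_of` (kernel-checked, no `sorry` outside `stub_*`): (S1) and (Σ5) are
lifted from separated tensors to `⁰𝒮` by totality applied to the pair of functionals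
`(S n σ) ∘ linActMulti A`, `S n σ`; then `Upgrade.upgrade S` (closed-subgroup argument: Niven
`arccos(3/5)/π ∉ ℚ`, `AddSubgroup.dense_or_cyclic`, conjugation into every coordinate plane, Givens
generation, continuity of `t ↦ linActMulti (planeRot 0 t) F` in `𝓢`) gives every determinant-one
isometry.  `RotationRestoration_of` concludes the PRIMARY copy
`FourMirrorsWardE1.RotationRestoration` BY NAME; `_of_diagonalSpine` / `_of_gapBuysCauchyRate` serve the
two verbatim copies.

## Negative knowledge honoured (no `Disproof.lean` on this crux yet, `ledger crux ls` 2026-08-17)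
* Refuter crux-attack 2026-08-15 SURVIVES; its junk regimes: `z ≡ 0` schemes tie only `S|⁰𝒮 = 0`
  (conclusion then trivial — §4 below proves the Σ5 stub's conclusion on that slice, sorry-free),
  `N_f ≥ 17` (`b₀ < 0`, `β_k → −∞`) is kept verbatim in the hard stub's hypotheses exactly as birth's S2.
* Yang–Mills twin crux `PencilRigidity.NPointIsotropy` (stmt-11686) Disproof v7d: the MODEL-BLIND form is
  false from degree 4 (`not_NPointIsotropyModelBlind`) and the TIE is the load-bearing clause
  (`not_withoutTieAt4`); conclusion on all of `𝓢` is false (`not_onAllTests`).  Here every stub keeps the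
  lattice tie (`IsLatticeLimit`) as hypothesis and every conclusion lives on separated tensors / `⁰𝒮`.
* This route's own negative cruxes (`NoDiagonalFermionRP`, `PseudoscalarDiagonalRPFails`): the Σ5 engine
  uses NO diagonal mirror (`R` is not a reflection and the comparison uses axis/site RP only), so it is the
  one Yang–Mills E1 engine that survives "four mirrors, not sixteen" (the sixteen-mirror cone engine of
  `IsotropyFromPowerCounting` needs `DiagonalMirrorRPR`, unavailable for `r = 1` Wilson quarks).
* `ledger negatives --problem QuantumFields` (5 entries): none concerns E1 of lattice limits.
-/

noncomputable section

-- Mathlib's `SimplexCategory` instance `Fintype (Fin (x.len + 1))` matches `Fintype (Fin 4)` (tree-known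
-- workaround, as in `Lines/birth.lean`).
attribute [-instance] SimplexCategory.instFintypeToTypeOrderHomFinHAddNatLenOfNat

namespace Summit.QuantumFields.QCD.Cruxes.RotationRestoration.SigmaFiveAmnesia

open scoped BigOperators Topology SchwartzMap
open Filter
open Literature.MathematicalPhysics.QuantumLattice Literature.MathematicalPhysics.AQFT
  Literature.MathematicalPhysics.QuantumFieldTheory
open Summit.QuantumFields.QCD.Theses.FourMirrorsWardE1 (RotationRestoration)

/-- `ℝ⁴` (file-local notation). -/
local notation "E4" => EuclideanSpace ℝ (Fin 4)

/-! ## §0 Vocabulary (verbatim with `Lines/birth.lean`, plus the Σ5 isometry) -/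

/-- The convergence clause of the crux (the lattice TIE), verbatim. -/
def IsLatticeLimit {Nf : ℕ} (sch : QCDScheme Nf)
    (S : LabelledSchwingerFamily (QCDField Nf) E4) : Prop :=
  ∀ n : ℕ, n ≠ 0 → ∀ (σ : Fin n → QCDField Nf) (f : Fin n → 𝓢(E4, ℝ)) (F : 𝓢((Fin n → E4), ℂ)),
    IsTensorOf F (fun i => ofRealTest (f i)) → IsOffDiagonal F →
      Tendsto (fun k : ℕ => qcdLatticeSchwinger sch k n σ f) atTop (𝓝 (S n σ F))

/-- A SEPARATED family of real one-point test functions: compactly supported, pairwise disjoint supports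
(verbatim with birth). -/
def IsSeparated {n : ℕ} (f : Fin n → 𝓢(E4, ℝ)) : Prop :=
  (∀ i, HasCompactSupport (f i : E4 → ℝ)) ∧
    ∀ i j, i ≠ j → Disjoint (tsupport (f i : E4 → ℝ)) (tsupport (f j : E4 → ℝ))

/-- Proper signed permutations `W(B₄) ∩ SO(4)` (verbatim with birth; the shape consumed by `upgrade`). -/
def IsProperSignedPerm (g : E4 ≃ₗᵢ[ℝ] E4) : Prop :=
  LinearMap.det (g.toLinearEquiv : E4 →ₗ[ℝ] E4) = 1 ∧
    ∀ i : Fin 4, ∃ j : Fin 4, g (EuclideanSpace.single i 1) = EuclideanSpace.single j 1 ∨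
      g (EuclideanSpace.single i 1) = -EuclideanSpace.single j 1

/-- **The Σ5 coincidence rotation** of the spatial `(x₂,x₃)`-plane, `cos = 3/5`, `sin = 4/5`, fixing the
time axis `e₀` and `e₁` (the shape consumed by `upgrade`; `(3+4i)/5 = (2+i)²/5`, CSL index 5). -/
def IsSigmaFive (R : E4 ≃ₗᵢ[ℝ] E4) : Prop :=
  R (EuclideanSpace.single 0 1) = EuclideanSpace.single 0 1 ∧
    R (EuclideanSpace.single 1 1) = EuclideanSpace.single 1 1 ∧
      R (EuclideanSpace.single 2 1) =
          (3 / 5 : ℝ) • EuclideanSpace.single 2 1 + (4 / 5 : ℝ) • EuclideanSpace.single 3 1 ∧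
        R (EuclideanSpace.single 3 1) =
          -((4 / 5 : ℝ) • EuclideanSpace.single 2 1) + (3 / 5 : ℝ) • EuclideanSpace.single 3 1

/-! ## §1 The three stub statements -/

/-- **(S1) Exact lattice symmetry passes to the limit, on separated tensors** — VERBATIM with birth's
`HypercubicOnSeparatedTensors` (∀-law; size M/L): for every `N_f`, EVERY scheme and every limit family `S`
(convergence clause only), every proper signed permutation `g`, every separated real family `f` and every
tensor `F` of the `f_i`:  `S n σ (F ∘ g⁻¹) = S n σ F`. -/
def HypercubicOnSeparatedTensors : Prop :=
  ∀ (Nf : ℕ) (sch : QCDScheme Nf) (S : LabelledSchwingerFamily (QCDField Nf) E4),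
    IsLatticeLimit sch S →
      ∀ (n : ℕ) (σ : Fin n → QCDField Nf) (g : E4 ≃ₗᵢ[ℝ] E4), IsProperSignedPerm g →
        ∀ f : Fin n → 𝓢(E4, ℝ), IsSeparated f →
          ∀ F : 𝓢((Fin n → E4), ℂ), IsTensorOf F (fun i => ofRealTest (f i)) →
            S n σ (linActMulti g F) = S n σ F

/-- **(Σ5) Orientation amnesia for ONE commensurate spatial rotation, on separated tensors** (THE hard
stub; open-problem).  Under the crux's hypotheses — two-loop asymptotic scaling, bare masses eventually on
the physical branch, a uniform lattice mass gap, and the convergence clause — `S n σ (F ∘ R⁻¹) = S n σ F`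
for the Σ5 rotation `R` of the `(x₂,x₃)`-plane and every separated real tensor `F` (all species strings).
Why plausibly true: Wilson lattice QCD on `a_kℤ⁴` and on `R(a_kℤ⁴)` are the same theory up to relabelling;
`R` fixes `e₀, e₁`, so both are site-reflection positive in the SAME Euclidean time with Lüscher's transfer
matrix at the same `(β_k, m_f(k))`, and share the index-5 time-slice sublattice `Γ`; orientation memory on
Γ-measurable separated observables is carried only by `W(B₄)`-scalar `O(4)`-breaking operators of dimension
≥ 6 (`a_k²` up to logarithms at the asymptotically free fixed point).  Why it might fail: as birth's S2 —
stated for every `N_f` (≥ 17 is a junk regime), all `z_s(k)`, every sequential limit incl. schemes near Aoki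
fingers; the irrelevance of the dimension-6 operators THROUGH THE CROSSOVER is an unbuilt non-perturbative
RG output (no small parameter but `(a/ℓ)²`). -/
def SigmaFiveOnSeparatedTensors : Prop :=
  ∀ (Nf : ℕ) (sch : QCDScheme Nf), sch.HasAsymptoticScaling →
    (∀ fl : Fin Nf, ∀ᶠ k in atTop, -1 < sch.mq fl k) →
      (∃ Δ : ℝ, 0 < Δ ∧ sch.HasLatticeMassGap Δ) →
        ∀ S : LabelledSchwingerFamily (QCDField Nf) E4, IsLatticeLimit sch S →
          ∀ R : E4 ≃ₗᵢ[ℝ] E4, IsSigmaFive R →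
            ∀ (n : ℕ) (σ : Fin n → QCDField Nf) (f : Fin n → 𝓢(E4, ℝ)), IsSeparated f →
              ∀ F : 𝓢((Fin n → E4), ℂ), IsTensorOf F (fun i => ofRealTest (f i)) →
                S n σ (linActMulti R F) = S n σ F

/-- **(S3) Separated real tensors are total in `⁰𝒮`** — VERBATIM with birth's `SeparatedTensorsTotal`
(functional analysis; size L): two continuous linear functionals on `𝓢((ℝ⁴)ⁿ, ℂ)` agreeing on the
complexified real tensors with compactly supported, pairwise disjoint factors agree on every test function
flat on the coincidence locus. -/
def SeparatedTensorsTotal : Prop :=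
  ∀ (n : ℕ) (T₁ T₂ : 𝓢((Fin n → E4), ℂ) →L[ℂ] ℂ),
    (∀ f : Fin n → 𝓢(E4, ℝ), IsSeparated f →
      ∀ F : 𝓢((Fin n → E4), ℂ), IsTensorOf F (fun i => ofRealTest (f i)) → T₁ F = T₂ F) →
      ∀ F : 𝓢((Fin n → E4), ℂ), IsOffDiagonal F → T₁ F = T₂ F

/-! ## §2 The registered stubs (the ONLY `sorry`s of this file) -/

/-- (S1) exact lattice symmetry passes to the limit on separated tensors — size M/L; byte-identical with
the birth line's stub of the same name. -/
theorem stub_hypercubicOnSeparatedTensors : HypercubicOnSeparatedTensors := by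
  sorry

/-- (Σ5) orientation amnesia for the Σ5 spatial rotation on separated tensors — the hard stub. -/
theorem stub_sigmaFiveOnSeparatedTensors : SigmaFiveOnSeparatedTensors := by
  sorry

/-- (S3) separated real tensors are total in `⁰𝒮` — size L; byte-identical with the birth line's stub. -/
theorem stub_separatedTensorsTotal : SeparatedTensorsTotal := by
  sorry

/-! ### Name-keyed aliases of the three statements (hypotheses of the composition; device of birth) -/
namespace Registered

/-- Alias of `HypercubicOnSeparatedTensors` keyed by the registered stub name. -/
abbrev stub_hypercubicOnSeparatedTensors : Prop := HypercubicOnSeparatedTensors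
/-- Alias of `SigmaFiveOnSeparatedTensors` keyed by the registered stub name. -/
abbrev stub_sigmaFiveOnSeparatedTensors : Prop := SigmaFiveOnSeparatedTensors
/-- Alias of `SeparatedTensorsTotal` keyed by the registered stub name. -/
abbrev stub_separatedTensorsTotal : Prop := SeparatedTensorsTotal

end Registered

/-! ## §3 Composition (kernel-checked; no `sorry` below this line) -/

open Summit.QuantumFields.YangMills.Theorems.OSLegsFromFemtoAndGap.Upgrade (upgrade)

/-- **The crux from the three stubs** (concludes the PRIMARY copy `FourMirrorsWardE1.RotationRestoration`
BY NAME).  Tensor-level invariance under the proper signed permutations (S1) and under the Σ5 rotation (Σ5)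
is lifted to `⁰𝒮` by totality (S3) applied to the functionals `(S n σ) ∘ linActMulti A` and `S n σ`; the
landed `upgrade` (Niven + closed subgroups of `ℝ` + Givens generation + orbit continuity in `𝓢`) concludes. -/
theorem RotationRestoration_of (hH : Registered.stub_hypercubicOnSeparatedTensors)
    (hS5 : Registered.stub_sigmaFiveOnSeparatedTensors) (hT : Registered.stub_separatedTensorsTotal) :
    RotationRestoration := by
  intro Nf sch hAF hbr hgap S hconv n σ Rot hdet F hF
  have hlim : IsLatticeLimit sch S := hconv
  refine upgrade S ?_ ?_ n σ Rot hdet F hF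
  · -- (HYP-CUBIC): tensor level (S1) lifted to `⁰𝒮` by totality (S3)
    intro m τ A hA hp G hG
    exact hT m ((S m τ).comp (linActMulti A)) (S m τ)
      (fun f hf G' hG' => hH Nf sch S hlim m τ A ⟨hA, hp⟩ f hf G' hG') G hG
  · -- (HYP-Σ5): tensor level (Σ5) lifted to `⁰𝒮` by totality (S3)
    intro A hA m τ G hG
    exact hT m ((S m τ).comp (linActMulti A)) (S m τ)
      (fun f hf G' hG' => hS5 Nf sch hAF hbr hgap S hlim A hA m τ f hf G' hG') G hG

/-- The crux along this skeleton, from the registered stubs (sorries only inside `stub_*`): the hypothesis-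
free `<Crux>_proof` the skeleton check reads, under the primary name. -/
theorem RotationRestoration_proof : RotationRestoration :=
  RotationRestoration_of stub_hypercubicOnSeparatedTensors stub_sigmaFiveOnSeparatedTensors
    stub_separatedTensorsTotal

/-- Composition, concluding the copy `DiagonalSpine.RotationRestoration` (verbatim, definitionally equal). -/
theorem RotationRestoration_of_diagonalSpine (hH : Registered.stub_hypercubicOnSeparatedTensors)
    (hS5 : Registered.stub_sigmaFiveOnSeparatedTensors) (hT : Registered.stub_separatedTensorsTotal) :
    Summit.QuantumFields.QCD.Theses.DiagonalSpine.RotationRestoration :=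
  RotationRestoration_of hH hS5 hT

/-- Composition, concluding the copy `GapBuysCauchyRate.RotationRestoration` (verbatim, definitionally equal). -/
theorem RotationRestoration_of_gapBuysCauchyRate (hH : Registered.stub_hypercubicOnSeparatedTensors)
    (hS5 : Registered.stub_sigmaFiveOnSeparatedTensors) (hT : Registered.stub_separatedTensorsTotal) :
    Summit.QuantumFields.QCD.Theses.GapBuysCauchyRate.RotationRestoration :=
  RotationRestoration_of hH hS5 hT

/-! ## §4 In-Lean cheapest check: the junk slice `z ≡ 0` satisfies the hard stub's conclusion

On every scheme whose species renormalisations vanish identically, every honest lattice `n`-point function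
with `n ≠ 0` is `0`, so a tied family vanishes on off-diagonal real tensors and the conclusion of
`SigmaFiveOnSeparatedTensors` holds there for EVERY linear isometry (degree `0`: the action on `𝓢` of a
point is trivial).  This is the QCD twin of the Yang–Mills disprover's `conclusion_on_tensors_of_c_eq_zero`
and shows the degenerate inhabitants of the hypotheses (`QCDScheme.zeroAF`-type schemes) are not witnesses
against the stub. -/

/-- With `z ≡ 0` every lattice `n`-point function, `n ≠ 0`, vanishes. [folklore] -/
theorem qcdLatticeSchwinger_eq_zero_of_z {Nf : ℕ} (sch : QCDScheme Nf) (hz : ∀ s k, sch.z s k = 0)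
    (k n : ℕ) (hn : n ≠ 0) (σ : Fin n → QCDField Nf) (f : Fin n → 𝓢(E4, ℝ)) :
    qcdLatticeSchwinger sch k n σ f = 0 := by
  obtain ⟨j, rfl⟩ := Nat.exists_eq_succ_of_ne_zero hn
  simp [qcdLatticeSchwinger, smearedInsertion, List.ofFn_succ, hz]

/-- On the junk slice `z ≡ 0` a tied family vanishes on off-diagonal real tensors of positive degree. -/
theorem apply_eq_zero_of_z {Nf : ℕ} {sch : QCDScheme Nf} (hz : ∀ s k, sch.z s k = 0)
    {S : LabelledSchwingerFamily (QCDField Nf) E4} (hS : IsLatticeLimit sch S)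
    {n : ℕ} (hn : n ≠ 0) (σ : Fin n → QCDField Nf) (f : Fin n → 𝓢(E4, ℝ))
    (F : 𝓢((Fin n → E4), ℂ)) (hF : IsTensorOf F (fun i => ofRealTest (f i))) (hF' : IsOffDiagonal F) :
    S n σ F = 0 := by
  have h := hS n hn σ f F hF hF'
  have h0 : Tendsto (fun k : ℕ => qcdLatticeSchwinger sch k n σ f) atTop (𝓝 0) := by
    simp_rw [qcdLatticeSchwinger_eq_zero_of_z sch hz _ n hn]
    exact tendsto_const_nhds
  exact tendsto_nhds_unique h h0

end Summit.QuantumFields.QCD.Cruxes.RotationRestoration.SigmaFiveAmnesia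

end
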